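import Literature.AlgebraicGeometry.Milne1999.SpecialLefschetzGroupCMProducts
import Literature.AlgebraicGeometry.Milne1999.LefschetzGroupCharacter
import HarnessLib

/-!
# `(L(A), l(A)) = (T^Ψ, t^Ψ)` in coordinates, and the Lefschetz group of a product of two Hom-orthogonal CM abelian
# varieties: `L(A × B)(ℂ) ≅ (ℂˣ)^Φ × (ℂˣ)^Ψ × ℂˣ` (Milne 1999: Prop. 2.5 with Def. 4.6 / Cor. 4.7, the fibre product over `𝔾_m`)

Family `hodge`, layer `Literature/AlgebraicGeometry/Milne1999`, namespace `Literature.AlgebraicGeometry.Milne1999`.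
THEOREMS ONLY (no definition, no named fact; D-0026 net debt 0).  Sequel of `Milne1999/LefschetzGroupCMTorus`
(`ker l(A)(ℂ) ≃* (Φ → ℂˣ)`, `L(A)(ℂ) ≃* (Φ → ℂˣ) × ℂˣ` as ABSTRACT groups, `Nonempty`), of `Milne1999/LefschetzGroupCharacter`
(Milne's character `l` is the similitude multiplier on `H¹`, for a polarization class) and of
`Milne1999/SpecialLefschetzGroupCMProducts` (`ker l(A × B)(ℂ) ≃* (Φ → ℂˣ) × (Ψ → ℂˣ)` for Hom-orthogonal CM realisations).

Milne [Milne1999, §2 Prop. 2.5]: «For any `Ψ`, `(L(A_Ψ), l(A_Ψ)) = (T^Ψ, t^Ψ)`», `T^Ψ(ℚ) = {a ∈ E^× | a · ιa ∈ ℚ^×}`,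
`t^Ψ(a) = a · ιa` (A.7), for a CM-type `Ψ` on a CM-ALGEBRA `E = ∏ Eᵢ`; [Milne1999LefschetzClasses, Def. 4.6, Cor. 4.7]:
«an isogeny `A → A₁^{r₁} × ⋯ × A_s^{r_s}` […] defines an isomorphism `(L(A), l(A)) → ∏ᵢ (L(Aᵢ), l(Aᵢ))`», the product
being the FIBRE PRODUCT over the characters `l(Aᵢ) : L(Aᵢ) → 𝔾_m`.  For a realisation `(A, ι, θ)` of a CM type `(K; Φ)`
read on `H¹` (`IsCMTypeRealisation`, `θ(K) ⊆ C(A)`) and a `θ`-eigenbasis `v` of `H¹(A(ℂ); ℂ)`: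

* §1 **the coordinates `(d|_Φ, l)` on `L(A)(ℂ)`, with the second coordinate IDENTIFIED AS MILNE'S `l`**: if `g ∈ L(A)(ℂ)`
  has `g₁ v_σ = d_σ v_σ` and `d_σ d_σ̄ = c`, then `Q_h(g₁x, g₁y) = c · Q_h(x, y)` for EVERY polarization class `h` of `A`
  (`polarizationPairingOne_eq_smul_of_mem_lefschetzGroup_of_eigenvalues` — not only the Rosati-compatible ones of
  `LefschetzGroupCMTorus`), so `g` acts on the Lefschetz classes of degree `2p` by `cᵖ`
  (`apply_eq_pow_smul_of_mem_lefschetzGroup_of_eigenvalues`); and there are group isomorphisms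
  **`e : ker l(A)(ℂ) ≃* (Φ → ℂˣ)`** with `g₁ v_φ = e(g)_φ v_φ`, `g₁ v_φ̄ = e(g)_φ⁻¹ v_φ̄`
  (`exists_specialLefschetzGroup_mulEquiv_pi_units_apply_basis`) and **`e : L(A)(ℂ) ≃* (Φ → ℂˣ) × ℂˣ`** with
  `g₁ v_φ = e(g)₁(φ) v_φ`, `g₁ v_φ̄ = e(g)₂ e(g)₁(φ)⁻¹ v_φ̄`, `Q_h(g₁x, g₁y) = e(g)₂ Q_h(x, y)` for every polarization class,
  `g = e(g)₂ᵖ` on `D^p(A) ⊗ ℂ`, `e(g)₂ = 1 ⟺ g ∈ ker l(A)`, `e(w(c)) = (c, c²)`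
  (`exists_lefschetzGroup_mulEquiv_pi_units_prod_apply_basis`) — «`T^Ψ = {α | α · ια ∈ 𝔾_m}`, `t^Ψ(α) = α · ια`».
* §2 **`G(A)(h_A) ×_{𝔾_m} G(B)(h_B)` in coordinates** for realisations `A` of `(K; Φ)`, `B` of `(K'; Ψ)` and ANY polarization
  classes `h_A`, `h_B`: `similitudeCentralizerGroupFibreProd A B h_A h_B ≃* (Φ → ℂˣ) × (Ψ → ℂˣ) × ℂˣ`, the last coordinate
  being the common multiplier (`exists_similitudeCentralizerGroupFibreProd_mulEquiv_pi_units_prod`); hence, for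
  `Hom(A, B) = 0 = Hom(B, A)` (Cor. 4.7), **`L(A × B)(ℂ) ≃* (Φ → ℂˣ) × (Ψ → ℂˣ) × ℂˣ`**
  (`nonempty_lefschetzGroup_prod_mulEquiv_pi_units_prod_pi_units_prod`), the same for every `X ∼ A^{r+1} × B^{s+1}`, the
  split forms `≃* (Fin (dim A) → ℂˣ) × (Fin (dim B) → ℂˣ) × ℂˣ` (a torus of rank `dim A + dim B + 1 = dim (A × B) + 1` —
  the torus `T^Ψ` of the CM algebra `K × K'`), and the simple non-isogenous case (Hom-orthogonality automatic).
* §3 «`L(A) ⊃ Hg(A)`» (p. 660) in Milne's `GL × 𝔾_m` convention: `MT(X)(ℂ)` embeds in `(Φ → ℂˣ) × (Ψ → ℂˣ) × ℂˣ`, is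
  commutative, and is all of the torus iff `X` is stably nondegenerate (Prop. 4.8 (a) ⟺ (b)).

## Sources read, verbatim

* J. S. Milne, *Lefschetz motives and the Tate conjecture*, Compositio Math. 117 (1999) 47–81
  [`paper:doi-10-1023-a-1000776613765`], §2 Prop. 2.5 and its proof («`L(A_Ψ)(ℚ) = {α ∈ E_ψ^× | α · ια ∈ ℚ^×}` and its
  canonical character `l(A_Ψ)` sends `α` to `α · ια`»), A.7 (CM-types on CM-algebras), §1 Rem. 1.10
  («`L₀(A)(R) = {(γ, c) ∈ C₀(A)^× × R^× | γ†γ = c}`»).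
* J. S. Milne, *Lefschetz classes on abelian varieties*, Duke Math. J. 96 (1999) 639–675
  [`paper:doi-10-1215-s0012-7094-99-09620-5`], §1 Prop. 1.5 (p. 644), §3 p. 657 (the characters `ξ_σ`), §4 Def. 4.3,
  Thm. 4.4, Def. 4.6, Cor. 4.7, Prop. 4.8 (pp. 659–660).
* D. Mumford, *Abelian varieties* (1970), §19 Cor. 2 of Thm. 1 (p. 174).

## What is NOT here

* `T^Ψ` as a torus over `ℚ`, its character module, Thm. 2.6; the image of `MT(X)(ℂ)` for DEGENERATE types (reflex norm).
* Products with `≥ 3` isogeny types, and non-orthogonal mixed powers beyond `X ∼ A^{r+1} × B^{s+1}`.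

## References

* [Milne1999] J. S. Milne, Lefschetz motives and the Tate conjecture, Compositio Math. 117 (1999): §1 Rem. 1.10, §2 Prop. 2.5, A.7.
* [Milne1999LefschetzClasses] J. S. Milne, Lefschetz classes on abelian varieties, Duke Math. J. 96 (1999): Prop. 1.5, §3 p. 657,
  Def. 4.3, Thm. 4.4, Def. 4.6, Cor. 4.7, Prop. 4.8.
* [MumfordAV1970] D. Mumford, Abelian varieties (1970), §19.
* [Gordon1999HodgeAVSurvey] B. B. Gordon, A survey of the Hodge conjecture for abelian varieties (1999), Thm. 7.5, Def. 7.6.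
-/

noncomputable section

open CategoryTheory NumberField
open Literature.AlgebraicTopology.SingularHomology
open Literature.AlgebraicGeometry.HodgeTheory
open Literature.AlgebraicGeometry.Motives
open Literature.AlgebraicGeometry.ComplexMultiplication (IsCMTypeRealisation)
open Literature.Barriers.HodgeConjecture (divisorClassesSpan)
open NumberField.ComplexEmbedding (conjugate)

namespace Literature.AlgebraicGeometry.Milne1999

variable {K : Type} [Field K] [NumberField K] {Φ : CMType K} {A : AbelianVariety ℂ}
  {ι : 𝓞 K →+* End A} {θ : K →+* Module.End ℂ (complexBetti A.X 1)}
  {v : Module.Basis (K →+* ℂ) ℂ (complexBetti A.X 1)}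

/-! ### §0 Bookkeeping: CM types, eigenvalues, the similitude extension `(e, c) ↦ (e on Φ, c·e⁻¹ on Φ̄)` -/

section Bookkeeping

omit [NumberField K] in
/-- `φ ∈ Φ ⟹ φ̄ ∉ Φ`. [folklore] -/
private theorem conjugate_not_mem_of_mem (Φ : CMType K) {φ : K →+* ℂ} (h : φ ∈ Φ.1) : conjugate φ ∉ Φ.1 :=
  (Φ.2 φ).1 h

omit [NumberField K] in
/-- `σ ∉ Φ ⟹ σ̄ ∈ Φ`. [folklore] -/
private theorem conjugate_mem_of_not_mem (Φ : CMType K) {σ : K →+* ℂ} (h : σ ∉ Φ.1) : conjugate σ ∈ Φ.1 := by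
  by_contra h'
  exact h ((Φ.2 σ).2 h')

/-- A realisation has positive dimension. [folklore] -/
private theorem one_le_dim (hA : IsCMTypeRealisation Φ A ι θ) : 1 ≤ A.dim := by
  have h1 := AbelianVariety.finrank_complexBetti_one A
  rw [hA.2.1] at h1
  have h2 : 0 < Module.finrank ℚ K := Module.finrank_pos
  omega

/-- The CM type of a realisation is non-empty (`|Φ| = dim A ≥ 1`). [folklore] -/
private theorem cmType_nonempty (hA : IsCMTypeRealisation Φ A ι θ) : Φ.1.Nonempty :=
  Set.nonempty_of_ncard_ne_zero (by rw [hA.ncard_cmType_eq_dim]; have := one_le_dim hA; omega)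

/-- `(ℂˣ)^Φ ≃* (ℂˣ)^{dim A}` (`|Φ| = dim A`). [cite: Deligne1982HodgeCycles, Example 3.7] -/
private theorem nonempty_pi_units_mulEquiv_fin (hA : IsCMTypeRealisation Φ A ι θ) :
    Nonempty ((Φ.1 → ℂˣ) ≃* (Fin A.dim → ℂˣ)) := by
  haveI : Finite Φ.1 := Set.toFinite Φ.1
  have hcard : Nat.card Φ.1 = A.dim := by rw [Nat.card_coe_set_eq, hA.ncard_cmType_eq_dim]
  exact ⟨MulEquiv.arrowCongr ((Finite.equivFin Φ.1).trans (finCongr hcard)) (MulEquiv.refl ℂˣ)⟩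

omit [NumberField K] in
/-- Eigenvalues on a basis determine the automorphism. [folklore] -/
private theorem eq_of_apply_basis_eq_smul {u u' : complexBetti A.X 1 ≃ₗ[ℂ] complexBetti A.X 1} {d : (K →+* ℂ) → ℂ}
    (hd : ∀ σ, u (v σ) = d σ • v σ) (hd' : ∀ σ, u' (v σ) = d σ • v σ) : u = u' :=
  v.ext' fun σ ↦ by rw [hd, hd']

omit [NumberField K] in
/-- Equal diagonal automorphisms have equal eigenvalues. [folklore] -/
private theorem eigenvalue_eq_of_eq {u : complexBetti A.X 1 ≃ₗ[ℂ] complexBetti A.X 1} {d d' : (K →+* ℂ) → ℂ}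
    (hd : ∀ σ, u (v σ) = d σ • v σ) (hd' : ∀ σ, u (v σ) = d' σ • v σ) (σ : K →+* ℂ) : d σ = d' σ :=
  smul_left_injective ℂ (v.ne_zero σ) ((hd σ).symm.trans (hd' σ))

/-- The scalar automorphism `c · id`, evaluated. [folklore] -/
private theorem smulOfUnit_apply_eq (c : ℂˣ) (x : complexBetti A.X 1) : LinearEquiv.smulOfUnit c x = (c : ℂ) • x := by
  simp [LinearEquiv.smulOfUnit, Units.smul_def]

omit [NumberField K] in
/-- **The similitude extension** `(e, c) ↦ d` with `d_φ = e_φ` on `Φ`, `d_φ̄ = c · e_φ⁻¹` on `Φ̄`, as a group homomorphism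
`(ℂˣ)^Φ × ℂˣ → (ℂˣ)^{Hom(K, ℂ)}` onto `{d | d_σ d_σ̄ = c}` — the parametrisation of `T^Ψ(ℂ)` by `X^*(T^Ψ) ≅ ⊕_{φ ∈ Φ} ℤξ_φ ⊕ ℤ`.
[cite: Milne1999, §2 Prop. 2.5 and A.7] [cite: Milne1999LefschetzClasses, §3 p. 657] -/
private theorem exists_similitudeExtensionHom (Φ : CMType K) :
    ∃ X : (Φ.1 → ℂˣ) × ℂˣ →* ((K →+* ℂ) → ℂˣ),
      (∀ (ec : (Φ.1 → ℂˣ) × ℂˣ) (φ : Φ.1), X ec φ = ec.1 φ) ∧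
      (∀ (ec : (Φ.1 → ℂˣ) × ℂˣ) (φ : Φ.1), X ec (conjugate φ) = ec.2 * (ec.1 φ)⁻¹) ∧
      (∀ (ec : (Φ.1 → ℂˣ) × ℂˣ) (σ : K →+* ℂ), X ec σ * X ec (conjugate σ) = ec.2) ∧
      ∀ (ec : (Φ.1 → ℂˣ) × ℂˣ) (d : (K →+* ℂ) → ℂˣ), (∀ φ : Φ.1, d φ = ec.1 φ) →
        (∀ σ, d σ * d (conjugate σ) = ec.2) → X ec = d := by
  classical
  let X₀ : (Φ.1 → ℂˣ) × ℂˣ → (K →+* ℂ) → ℂˣ := fun ec σ ↦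
    if hσ : σ ∈ Φ.1 then ec.1 ⟨σ, hσ⟩ else ec.2 * (ec.1 ⟨conjugate σ, conjugate_mem_of_not_mem Φ hσ⟩)⁻¹
  have hΦ : ∀ (ec : (Φ.1 → ℂˣ) × ℂˣ) (σ : K →+* ℂ) (hσ : σ ∈ Φ.1), X₀ ec σ = ec.1 ⟨σ, hσ⟩ := fun ec σ hσ ↦ by
    simp only [X₀, dif_pos hσ]
  have hΦc : ∀ (ec : (Φ.1 → ℂˣ) × ℂˣ) (σ : K →+* ℂ) (hσ : σ ∉ Φ.1),
      X₀ ec σ = ec.2 * (ec.1 ⟨conjugate σ, conjugate_mem_of_not_mem Φ hσ⟩)⁻¹ := fun ec σ hσ ↦ by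
    simp only [X₀, dif_neg hσ]
  have hc : ∀ (ec : (Φ.1 → ℂˣ) × ℂˣ) (φ : K →+* ℂ) (hφ : φ ∈ Φ.1), X₀ ec (conjugate φ) = ec.2 * (ec.1 ⟨φ, hφ⟩)⁻¹ :=
    fun ec φ hφ ↦ by
      have hσ : conjugate φ ∉ Φ.1 := conjugate_not_mem_of_mem Φ hφ
      have e : (⟨conjugate (conjugate φ), conjugate_mem_of_not_mem Φ hσ⟩ : Φ.1) = ⟨φ, hφ⟩ :=
        Subtype.ext (NumberField.ComplexEmbedding.involutive_conjugate K φ)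
      rw [hΦc ec (conjugate φ) hσ, e]
  have hmul : ∀ ec ec' : (Φ.1 → ℂˣ) × ℂˣ, X₀ (ec * ec') = X₀ ec * X₀ ec' := fun ec ec' ↦ funext fun σ ↦ by
    by_cases hσ : σ ∈ Φ.1
    · rw [Pi.mul_apply, hΦ ec σ hσ, hΦ ec' σ hσ, hΦ (ec * ec') σ hσ, Prod.fst_mul, Pi.mul_apply]
    · rw [Pi.mul_apply, hΦc ec σ hσ, hΦc ec' σ hσ, hΦc (ec * ec') σ hσ, Prod.snd_mul, Prod.fst_mul, Pi.mul_apply,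
        mul_inv]
      exact mul_mul_mul_comm _ _ _ _
  refine ⟨MonoidHom.mk' X₀ hmul, fun ec φ ↦ hΦ ec φ.1 φ.2, fun ec φ ↦ hc ec φ.1 φ.2, fun ec σ ↦ ?_,
    fun ec d h1 h2 ↦ funext fun σ ↦ ?_⟩
  · show X₀ ec σ * X₀ ec (conjugate σ) = ec.2
    by_cases hσ : σ ∈ Φ.1
    · rw [hΦ ec σ hσ, hc ec σ hσ, mul_left_comm, mul_inv_cancel, mul_one]
    · rw [hΦc ec σ hσ, hΦ ec (conjugate σ) (conjugate_mem_of_not_mem Φ hσ), mul_assoc, inv_mul_cancel, mul_one]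
  · show X₀ ec σ = d σ
    by_cases hσ : σ ∈ Φ.1
    · exact (hΦ ec σ hσ).trans (h1 ⟨σ, hσ⟩).symm
    · have hσ' := conjugate_mem_of_not_mem Φ hσ
      have e1 : d (conjugate σ) = ec.1 ⟨conjugate σ, hσ'⟩ := h1 ⟨conjugate σ, hσ'⟩
      have e2 : d σ = ec.2 * (d (conjugate σ))⁻¹ := by rw [← h2 σ, mul_inv_cancel_right]
      rw [hΦc ec σ hσ, e2, e1]

end Bookkeeping

/-! ### §1 `(L(A), l(A)) = (T^Ψ, t^Ψ)` in coordinates: the multiplier for EVERY polarization class; explicit isomorphisms -/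

section Coordinates

variable [IsCMField K]

/-- **The multiplier of `g ∈ L(A)(ℂ)` is `d_σ d_σ̄`, for EVERY polarization class**: if `g₁ v_σ = d_σ v_σ` on a
`θ`-eigenbasis and `d_σ d_σ̄ = c`, then `Q_h(g₁x, g₁y) = c · Q_h(x, y)` for every polarization class `h` of `A` (rational,
supported on a divisor, hard Lefschetz) — `c` is the value at `g` of Milne's canonical character `l(A) : L(A) → 𝔾_m`
(«its canonical character `l(A_Ψ)` sends `α` to `α · ια`»; `L = w(𝔾_m) · ker l`, `l ∘ w = 2`, `ker l ⊆ Sp(Q_h)` by Thm. 4.4).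
No hypothesis on `θ(K)`. [cite: Milne1999, §2 Prop. 2.5] [cite: Milne1999LefschetzClasses, Def. 4.3, Thm. 4.4 and p. 659 (l ∘ w = -2)] -/
theorem polarizationPairingOne_eq_smul_of_mem_lefschetzGroup_of_eigenvalues (hA : IsCMTypeRealisation Φ A ι θ)
    (hv : ∀ (σ : K →+* ℂ) (a : K), θ a (v σ) = σ a • v σ)
    {g : ∀ k : ℕ, complexBetti A.X k ≃ₗ[ℂ] complexBetti A.X k} (hg : g ∈ lefschetzGroup A.dim A.X)
    {d : (K →+* ℂ) → ℂ} (hd : ∀ σ, g 1 (v σ) = d σ • v σ) {c : ℂ} (hc : ∀ σ, d σ * d (conjugate σ) = c)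
    {h : complexBetti A.X 2} (hpol : IsPolarizationClass A.dim A.X h) (x y : complexBetti A.X 1) :
    polarizationPairingOne A.X h (A.dim - 1) (g 1 x) (g 1 y) = c • polarizationPairingOne A.X h (A.dim - 1) x y := by
  have hA1 := one_le_dim hA
  obtain ⟨φ₀, -⟩ := cmType_nonempty hA
  obtain ⟨c₀, s, hs, rfl⟩ := mem_lefschetzGroup_iff_exists_weightCocharacter_mul.1 hg
  obtain ⟨d', hd', h1⟩ := exists_eigenvalues_of_mem_specialLefschetzGroup hA hv hs
  -- `g₁ = c₀ · s₁` is diagonal with eigenvalues `c₀ d'_σ`, so `d = c₀ d'` and `c = c₀²`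
  have hd₂ : ∀ σ, (weightCocharacter A.X c₀ * s) 1 (v σ) = ((c₀ : ℂ) * d' σ) • v σ := fun σ ↦ by
    rw [weightCocharacter_mul_apply_one, LinearEquiv.mul_apply, hd', map_smul, smulOfUnit_apply_eq, smul_smul, mul_comm]
  have hcc : c = (((c₀ ^ 2 : ℂˣ) : ℂ)) := by
    rw [← hc φ₀, eigenvalue_eq_of_eq hd hd₂ φ₀, eigenvalue_eq_of_eq hd hd₂ (conjugate φ₀), Units.val_pow_eq_pow_val,
      pow_two]
    calc (c₀ : ℂ) * d' φ₀ * ((c₀ : ℂ) * d' (conjugate φ₀)) = c₀ * c₀ * ((d' φ₀ : ℂ) * d' (conjugate φ₀)) := by ring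
      _ = c₀ * c₀ := by rw [h1 φ₀, mul_one]
  rw [Pi.mul_apply, LinearEquiv.mul_apply, LinearEquiv.mul_apply, polarizationPairingOne_weightCocharacter_one,
    ((hpol.mem_specialLefschetzGroup_iff_mem_lefschetzGroup hA1).1 hs).2 x y, hcc]

/-- **`l(g)` on the Lefschetz classes, read off the eigenvalues**: if `g ∈ L(A)(ℂ)` has `g₁ v_σ = d_σ v_σ`, `d_σ d_σ̄ = c`,
then `g x = cᵖ x` for every Lefschetz class `x` of degree `2p` on `A` (Def. 4.3: `L(A)` acts on `D^p(A)(p)` through `l`).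
No hypothesis on `θ(K)`. [cite: Milne1999LefschetzClasses, Def. 4.3 and p. 659] [cite: Milne1999, §2 Prop. 2.5] -/
theorem apply_eq_pow_smul_of_mem_lefschetzGroup_of_eigenvalues (hA : IsCMTypeRealisation Φ A ι θ)
    (hv : ∀ (σ : K →+* ℂ) (a : K), θ a (v σ) = σ a • v σ)
    {g : ∀ k : ℕ, complexBetti A.X k ≃ₗ[ℂ] complexBetti A.X k} (hg : g ∈ lefschetzGroup A.dim A.X)
    {d : (K →+* ℂ) → ℂˣ} (hd : ∀ σ, g 1 (v σ) = (d σ : ℂ) • v σ) {c : ℂˣ} (hc : ∀ σ, d σ * d (conjugate σ) = c)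
    {p : ℕ} {x : complexBetti A.X (2 * p)} (hx : x ∈ divisorClassesSpan A.X A.dim p) :
    g (2 * p) x = ((c : ℂ) ^ p) • x := by
  obtain ⟨h, hpol, -⟩ := hA.exists_isPolarizationClass_rosati
  have hc' : ∀ σ, (d σ : ℂ) * d (conjugate σ) = c := fun σ ↦ by rw [← Units.val_mul, hc]
  exact hpol.apply_eq_pow_smul_of_mem_lefschetzGroup (one_le_dim hA) hg
    (fun x y ↦ polarizationPairingOne_eq_smul_of_mem_lefschetzGroup_of_eigenvalues hA hv hg
      (d := fun σ ↦ (d σ : ℂ)) hd hc' hpol x y) hx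

/-- **`ker l(A)(ℂ) ≃* (ℂˣ)^Φ`, EXPLICITLY: the isomorphism reads off the eigenvalues on `Φ`** (`θ(K) ⊆ C(A)`, `v` a
`θ`-eigenbasis): `g₁ v_φ = e(g)_φ v_φ` and `g₁ v_φ̄ = e(g)_φ⁻¹ v_φ̄` for `φ ∈ Φ` — the characters `ξ_φ`, `φ ∈ Φ`, form a basis of
`X^*(S(A)) = ⊕ ℤξ_σ / ⟨ξ_σ + ξ_{ισ}⟩`. [cite: Milne1999LefschetzClasses, §3 p. 657] [cite: Milne1999, §2 Prop. 2.5] -/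
theorem exists_specialLefschetzGroup_mulEquiv_pi_units_apply_basis (hA : IsCMTypeRealisation Φ A ι θ)
    (hθ : ∀ a : K, θ a ∈ centralizerAlgebra A) (hv : ∀ (σ : K →+* ℂ) (a : K), θ a (v σ) = σ a • v σ) :
    ∃ e : specialLefschetzGroup A.dim A.X ≃* (Φ.1 → ℂˣ),
      (∀ (g : specialLefschetzGroup A.dim A.X) (φ : Φ.1),
        (g : ∀ k : ℕ, complexBetti A.X k ≃ₗ[ℂ] complexBetti A.X k) 1 (v φ) = ((e g φ : ℂˣ) : ℂ) • v φ) ∧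
      ∀ (g : specialLefschetzGroup A.dim A.X) (φ : Φ.1),
        (g : ∀ k : ℕ, complexBetti A.X k ≃ₗ[ℂ] complexBetti A.X k) 1 (v (conjugate φ)) =
          (((e g φ)⁻¹ : ℂˣ) : ℂ) • v (conjugate φ) := by
  classical
  obtain ⟨X, hX1, hX2, hX3, hX4⟩ := exists_similitudeExtensionHom Φ
  -- the unitary extension `X (e, 1)` of `e`
  have h1 : ∀ (e : Φ.1 → ℂˣ) (σ : K →+* ℂ), ((X (e, 1) σ : ℂˣ) : ℂ) * X (e, 1) (conjugate σ) = 1 := fun e σ ↦ by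
    rw [← Units.val_mul, hX3, Units.val_one]
  choose G hG huniq using fun e : Φ.1 → ℂˣ ↦
    existsUnique_mem_specialLefschetzGroup_of_eigenvalues hA hθ hv (X (e, 1)) (h1 e)
  have h11 : ((1 : Φ.1 → ℂˣ), (1 : ℂˣ)) = 1 := rfl
  have hmk : ∀ e e' : Φ.1 → ℂˣ, ((e * e', (1 : ℂˣ)) : (Φ.1 → ℂˣ) × ℂˣ) = (e, 1) * (e', 1) := fun e e' ↦ by
    rw [Prod.mk_mul_mk, mul_one]
  let F : (Φ.1 → ℂˣ) →* specialLefschetzGroup A.dim A.X :=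
    { toFun := fun e ↦ ⟨G e, (hG e).1⟩
      map_one' := Subtype.ext (by
        show G 1 = 1
        refine (huniq 1 1 ⟨one_mem _, fun σ ↦ ?_⟩).symm
        rw [h11, map_one, Pi.one_apply, Pi.one_apply, Units.val_one, one_smul]
        rfl)
      map_mul' := fun e e' ↦ Subtype.ext (by
        show G (e * e') = G e * G e'
        refine (huniq (e * e') (G e * G e') ⟨mul_mem (hG e).1 (hG e').1, fun σ ↦ ?_⟩).symm
        rw [Pi.mul_apply, LinearEquiv.mul_apply, (hG e').2, map_smul, (hG e).2, smul_smul, hmk, map_mul, Pi.mul_apply,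
          Units.val_mul, mul_comm]) }
  have hF : ∀ e, ((F e : specialLefschetzGroup A.dim A.X) : ∀ k : ℕ, complexBetti A.X k ≃ₗ[ℂ] complexBetti A.X k) = G e :=
    fun _ ↦ rfl
  have hbij : Function.Bijective F := by
    refine ⟨fun e e' h ↦ funext fun φ ↦ ?_, fun g ↦ ?_⟩
    · have h' : G e = G e' := congrArg Subtype.val h
      have key : X (e, 1) φ = X (e', 1) φ :=
        Units.ext (eigenvalue_eq_of_eq (d := fun σ ↦ ((X (e, 1) σ : ℂˣ) : ℂ)) (d' := fun σ ↦ ((X (e', 1) σ : ℂˣ) : ℂ))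
          (hG e).2 (fun σ ↦ by rw [h']; exact (hG e').2 σ) φ)
      rwa [hX1, hX1] at key
    · obtain ⟨d, hd, hd1⟩ := exists_eigenvalues_of_mem_specialLefschetzGroup hA hv g.2
      refine ⟨fun φ ↦ d φ, Subtype.ext ?_⟩
      rw [hF]
      have hXd : X (fun φ : Φ.1 ↦ d φ, 1) = d :=
        hX4 _ d (fun _ ↦ rfl) fun σ ↦ Units.ext (by rw [Units.val_mul, hd1 σ]; rfl)
      refine (huniq _ g.1 ⟨g.2, fun σ ↦ ?_⟩).symm
      rw [hXd, hd]
  refine ⟨(MulEquiv.ofBijective F hbij).symm, fun g φ ↦ ?_, fun g φ ↦ ?_⟩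
  · have key : G ((MulEquiv.ofBijective F hbij).symm g) = g.1 :=
      congrArg Subtype.val ((MulEquiv.ofBijective F hbij).apply_symm_apply g)
    rw [← key, (hG _).2, hX1]
  · have key : G ((MulEquiv.ofBijective F hbij).symm g) = g.1 :=
      congrArg Subtype.val ((MulEquiv.ofBijective F hbij).apply_symm_apply g)
    rw [← key, (hG _).2, hX2, one_mul]

/-- **`(L(A), l(A)) = (T^Ψ, t^Ψ)` on `ℂ`-points, EXPLICITLY** (`θ(K) ⊆ C(A)`, `v` a `θ`-eigenbasis): a group isomorphism
`e : L(A)(ℂ) ≃* (ℂˣ)^Φ × ℂˣ`, `e(g) = (d|_Φ, c)`, whose coordinates are the eigenvalues on `Φ` (`g₁ v_φ = d_φ v_φ`,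
`g₁ v_φ̄ = c d_φ⁻¹ v_φ̄`) and MILNE'S CHARACTER `l(g) = c`: `Q_h(g₁x, g₁y) = c · Q_h(x, y)` for EVERY polarization class `h`,
`g` acts on the Lefschetz classes of degree `2p` by `cᵖ`, `c = 1 ⟺ g ∈ ker l(A)` («the kernel of `l(A)` […] equals `S(A)`»),
and `e(w(c)) = (c, c²)` (`l ∘ w = 2` on cohomology). [cite: Milne1999, §2 Prop. 2.5 («(L(A_Ψ), l(A_Ψ)) = (T^Ψ, t^Ψ)») and A.7]
[cite: Milne1999LefschetzClasses, Def. 4.3, Thm. 4.4, p. 659 (ker l = S(A), l ∘ w = -2), §3 p. 657] -/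
theorem exists_lefschetzGroup_mulEquiv_pi_units_prod_apply_basis (hA : IsCMTypeRealisation Φ A ι θ)
    (hθ : ∀ a : K, θ a ∈ centralizerAlgebra A) (hv : ∀ (σ : K →+* ℂ) (a : K), θ a (v σ) = σ a • v σ) :
    ∃ e : lefschetzGroup A.dim A.X ≃* (Φ.1 → ℂˣ) × ℂˣ,
      (∀ (g : lefschetzGroup A.dim A.X) (φ : Φ.1),
        (g : ∀ k : ℕ, complexBetti A.X k ≃ₗ[ℂ] complexBetti A.X k) 1 (v φ) = (((e g).1 φ : ℂˣ) : ℂ) • v φ) ∧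
      (∀ (g : lefschetzGroup A.dim A.X) (φ : Φ.1),
        (g : ∀ k : ℕ, complexBetti A.X k ≃ₗ[ℂ] complexBetti A.X k) 1 (v (conjugate φ)) =
          (((e g).2 * ((e g).1 φ)⁻¹ : ℂˣ) : ℂ) • v (conjugate φ)) ∧
      (∀ (g : lefschetzGroup A.dim A.X) {h : complexBetti A.X 2}, IsPolarizationClass A.dim A.X h →
        ∀ x y : complexBetti A.X 1,
          polarizationPairingOne A.X h (A.dim - 1) ((g : ∀ k : ℕ, complexBetti A.X k ≃ₗ[ℂ] complexBetti A.X k) 1 x)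
            ((g : ∀ k : ℕ, complexBetti A.X k ≃ₗ[ℂ] complexBetti A.X k) 1 y) =
          (((e g).2 : ℂˣ) : ℂ) • polarizationPairingOne A.X h (A.dim - 1) x y) ∧
      (∀ (g : lefschetzGroup A.dim A.X) (p : ℕ), ∀ x ∈ divisorClassesSpan A.X A.dim p,
        (g : ∀ k : ℕ, complexBetti A.X k ≃ₗ[ℂ] complexBetti A.X k) (2 * p) x = ((((e g).2 : ℂˣ) : ℂ) ^ p) • x) ∧
      (∀ g : lefschetzGroup A.dim A.X, (e g).2 = 1 ↔
        (g : ∀ k : ℕ, complexBetti A.X k ≃ₗ[ℂ] complexBetti A.X k) ∈ specialLefschetzGroup A.dim A.X) ∧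
      ∀ c : ℂˣ, e ⟨weightCocharacter A.X c, weightCocharacter_mem_lefschetzGroup c⟩ = (fun _ ↦ c, c ^ 2) := by
  classical
  have hA1 := one_le_dim hA
  obtain ⟨φ₀, hφ₀⟩ := cmType_nonempty hA
  obtain ⟨hR, hpolR, -⟩ := hA.exists_isPolarizationClass_rosati
  obtain ⟨X, hX1, hX2, hX3, hX4⟩ := exists_similitudeExtensionHom Φ
  choose G hG huniq using fun ec : (Φ.1 → ℂˣ) × ℂˣ ↦
    existsUnique_mem_lefschetzGroup_of_eigenvalues hA hθ hv (X ec) (hX3 ec)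
  let F : (Φ.1 → ℂˣ) × ℂˣ →* lefschetzGroup A.dim A.X :=
    { toFun := fun ec ↦ ⟨G ec, (hG ec).1⟩
      map_one' := Subtype.ext (by
        show G 1 = 1
        refine (huniq 1 1 ⟨one_mem _, fun σ ↦ ?_⟩).symm
        rw [map_one, Pi.one_apply, Pi.one_apply, Units.val_one, one_smul]
        rfl)
      map_mul' := fun ec ec' ↦ Subtype.ext (by
        show G (ec * ec') = G ec * G ec'
        refine (huniq (ec * ec') (G ec * G ec') ⟨mul_mem (hG ec).1 (hG ec').1, fun σ ↦ ?_⟩).symm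
        rw [Pi.mul_apply, LinearEquiv.mul_apply, (hG ec').2, map_smul, (hG ec).2, smul_smul, map_mul, Pi.mul_apply,
          Units.val_mul, mul_comm]) }
  have hF : ∀ ec, ((F ec : lefschetzGroup A.dim A.X) : ∀ k : ℕ, complexBetti A.X k ≃ₗ[ℂ] complexBetti A.X k) = G ec :=
    fun _ ↦ rfl
  -- multiplier of `G ec` for every polarization class: `ec.2`
  have hmult : ∀ (ec : (Φ.1 → ℂˣ) × ℂˣ) {h : complexBetti A.X 2}, IsPolarizationClass A.dim A.X h →
      ∀ x y : complexBetti A.X 1, polarizationPairingOne A.X h (A.dim - 1) (G ec 1 x) (G ec 1 y) =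
        ((ec.2 : ℂˣ) : ℂ) • polarizationPairingOne A.X h (A.dim - 1) x y := fun ec h hpol x y ↦
    polarizationPairingOne_eq_smul_of_mem_lefschetzGroup_of_eigenvalues hA hv (hG ec).1
      (d := fun σ ↦ ((X ec σ : ℂˣ) : ℂ)) (hG ec).2 (fun σ ↦ by rw [← Units.val_mul, hX3]) hpol x y
  have hbij : Function.Bijective F := by
    refine ⟨fun ec ec' h ↦ ?_, fun g ↦ ?_⟩
    · have h' : G ec = G ec' := congrArg Subtype.val h
      have key : X ec = X ec' := funext fun σ ↦
        Units.ext (eigenvalue_eq_of_eq (d := fun σ ↦ ((X ec σ : ℂˣ) : ℂ)) (d' := fun σ ↦ ((X ec' σ : ℂˣ) : ℂ))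
          (hG ec).2 (fun σ ↦ by rw [h']; exact (hG ec').2 σ) σ)
      have k1 : X ec φ₀ * X ec (conjugate φ₀) = ec.2 := hX3 ec φ₀
      have k2 : X ec' φ₀ * X ec' (conjugate φ₀) = ec'.2 := hX3 ec' φ₀
      refine Prod.ext (funext fun φ ↦ ?_) ?_
      · rw [← hX1 ec φ, ← hX1 ec' φ, key]
      · rw [← k1, ← k2, key]
    · obtain ⟨d, c, hd, hdc⟩ := exists_eigenvalues_multiplier_of_mem_lefschetzGroup hA hv g.2
      refine ⟨(fun φ ↦ d φ, c), Subtype.ext ?_⟩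
      rw [hF]
      have hXd : X (fun φ : Φ.1 ↦ d φ, c) = d := hX4 _ d (fun _ ↦ rfl) hdc
      refine (huniq _ g.1 ⟨g.2, fun σ ↦ ?_⟩).symm
      rw [hXd, hd]
  set e := (MulEquiv.ofBijective F hbij).symm with he
  have key : ∀ g : lefschetzGroup A.dim A.X, G (e g) = g.1 := fun g ↦
    congrArg Subtype.val ((MulEquiv.ofBijective F hbij).apply_symm_apply g)
  refine ⟨e, fun g φ ↦ ?_, fun g φ ↦ ?_, fun g h hpol x y ↦ ?_, fun g p x hx ↦ ?_, fun g ↦ ?_, fun c ↦ ?_⟩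
  · rw [← key, (hG _).2, hX1]
  · rw [← key, (hG _).2, hX2]
  · rw [← key]
    exact hmult (e g) hpol x y
  · have hg : (g : ∀ k : ℕ, complexBetti A.X k ≃ₗ[ℂ] complexBetti A.X k) ∈ lefschetzGroup A.dim A.X := g.2
    refine hpolR.apply_eq_pow_smul_of_mem_lefschetzGroup hA1 hg (fun x y ↦ ?_) hx
    rw [← key]
    exact hmult (e g) hpolR x y
  · constructor
    · intro h1
      refine (hpolR.mem_specialLefschetzGroup_iff_mem_lefschetzGroup hA1).2 ⟨g.2, fun x y ↦ ?_⟩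
      rw [← key, hmult (e g) hpolR x y, h1, Units.val_one, one_smul]
    · intro hs
      refine multiplier_unique (u := g.1 1) (h := hR) (fun x y ↦ ?_) (fun x y ↦ ?_)
        (hpolR.exists_polarizationPairingOne_ne_zero hA1)
      · rw [← key]
        exact hmult (e g) hpolR x y
      · rw [Units.val_one, one_smul]
        exact ((hpolR.mem_specialLefschetzGroup_iff_mem_lefschetzGroup hA1).1 hs).2 x y
  · -- `F (c, c²) = w(c)`: `X (c, c²) ≡ c`, and `w(c)₁ = c · id`
    have hXc : X (fun _ : Φ.1 ↦ c, c ^ 2) = fun _ ↦ c := hX4 _ _ (fun _ ↦ rfl) fun _ ↦ (pow_two c).symm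
    have hGw : G (fun _ : Φ.1 ↦ c, c ^ 2) = weightCocharacter A.X c :=
      (huniq _ (weightCocharacter A.X c) ⟨weightCocharacter_mem_lefschetzGroup c, fun σ ↦ by
        rw [hXc, weightCocharacter_apply, pow_one]⟩).symm
    have hFw : F (fun _ : Φ.1 ↦ c, c ^ 2) = ⟨weightCocharacter A.X c, weightCocharacter_mem_lefschetzGroup c⟩ :=
      Subtype.ext hGw
    rw [he, ← hFw]
    exact (MulEquiv.ofBijective F hbij).symm_apply_apply _

end Coordinates

/-! ### §2 `G(A) ×_{𝔾_m} G(B)` in coordinates and `L(A × B)(ℂ) ≅ (ℂˣ)^Φ × (ℂˣ)^Ψ × ℂˣ` for Hom-orthogonal CM types -/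

section Products

variable [IsCMField K] {K' : Type} [Field K'] [NumberField K'] [IsCMField K'] {Ψ : CMType K'}
  {B X : AbelianVariety ℂ} {ι' : 𝓞 K' →+* End B} {θ' : K' →+* Module.End ℂ (complexBetti B.X 1)}
  {w : Module.Basis (K' →+* ℂ) ℂ (complexBetti B.X 1)} {hA₂ : complexBetti A.X 2} {hB₂ : complexBetti B.X 2}

/-- **The fibre product `G(A)(h_A) ×_{𝔾_m} G(B)(h_B)` (Def. 4.6) in coordinates** for realisations `A` of `(K; Φ)`, `B` of
`(K'; Ψ)` (`θ(K) ⊆ C(A)`, `θ'(K') ⊆ C(B)`, eigenbases `v`, `w`) and ANY polarization classes `h_A`, `h_B`: a group isomorphism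
onto `(ℂˣ)^Φ × (ℂˣ)^Ψ × ℂˣ`, `(p_A, p_B) ↦ (d|_Φ, d'|_Ψ, c)` — eigenvalues on `Φ`, on `Ψ`, and the COMMON multiplier `c`
(`p_A v_φ̄ = c d_φ⁻¹ v_φ̄`, `p_B w_ψ̄ = c d'_ψ⁻¹ w_ψ̄`, `Q_h(p_A x, p_A y) = c Q_h(x, y)` and `Q_{h'}(p_B x, p_B y) = c Q_{h'}(x, y)` for
all polarization classes `h`, `h'`): «the product `∏ (Gᵢ, tᵢ)` is the largest subgroup of `∏ Gᵢ` on which the characters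
agree», here `T^{Φ ⊔ Ψ}(ℂ)` of the CM algebra `K × K'`. [cite: Milne1999LefschetzClasses, Def. 4.6 and Cor. 4.7 (p. 660), Thm. 4.4]
[cite: Milne1999, §2 Prop. 2.5 and A.7] -/
theorem exists_similitudeCentralizerGroupFibreProd_mulEquiv_pi_units_prod (hA : IsCMTypeRealisation Φ A ι θ)
    (hθ : ∀ a : K, θ a ∈ centralizerAlgebra A) (hv : ∀ (σ : K →+* ℂ) (a : K), θ a (v σ) = σ a • v σ)
    (hB : IsCMTypeRealisation Ψ B ι' θ') (hθ' : ∀ b : K', θ' b ∈ centralizerAlgebra B)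
    (hw : ∀ (τ : K' →+* ℂ) (b : K'), θ' b (w τ) = τ b • w τ)
    (hpolA : IsPolarizationClass A.dim A.X hA₂) (hpolB : IsPolarizationClass B.dim B.X hB₂) :
    ∃ e : similitudeCentralizerGroupFibreProd A B hA₂ hB₂ ≃* (Φ.1 → ℂˣ) × (Ψ.1 → ℂˣ) × ℂˣ,
      ∀ p : similitudeCentralizerGroupFibreProd A B hA₂ hB₂,
        (∀ φ : Φ.1, p.1.1 (v φ) = (((e p).1 φ : ℂˣ) : ℂ) • v φ) ∧
        (∀ φ : Φ.1, p.1.1 (v (conjugate φ)) = (((e p).2.2 * ((e p).1 φ)⁻¹ : ℂˣ) : ℂ) • v (conjugate φ)) ∧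
        (∀ ψ : Ψ.1, p.1.2 (w ψ) = (((e p).2.1 ψ : ℂˣ) : ℂ) • w ψ) ∧
        (∀ ψ : Ψ.1, p.1.2 (w (conjugate ψ)) = (((e p).2.2 * ((e p).2.1 ψ)⁻¹ : ℂˣ) : ℂ) • w (conjugate ψ)) ∧
        (∀ {h : complexBetti A.X 2}, IsPolarizationClass A.dim A.X h → ∀ x y : complexBetti A.X 1,
          polarizationPairingOne A.X h (A.dim - 1) (p.1.1 x) (p.1.1 y) =
            (((e p).2.2 : ℂˣ) : ℂ) • polarizationPairingOne A.X h (A.dim - 1) x y) ∧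
        ∀ {h : complexBetti B.X 2}, IsPolarizationClass B.dim B.X h → ∀ x y : complexBetti B.X 1,
          polarizationPairingOne B.X h (B.dim - 1) (p.1.2 x) (p.1.2 y) =
            (((e p).2.2 : ℂˣ) : ℂ) • polarizationPairingOne B.X h (B.dim - 1) x y := by
  classical
  have hA1 := one_le_dim hA
  have hB1 := one_le_dim hB
  obtain ⟨φ₀, hφ₀⟩ := cmType_nonempty hA
  obtain ⟨XA, hXA1, hXA2, hXA3, hXA4⟩ := exists_similitudeExtensionHom Φ
  obtain ⟨XB, hXB1, hXB2, hXB3, hXB4⟩ := exists_similitudeExtensionHom Ψ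
  obtain ⟨DA, hDA⟩ := exists_eigenbasisDiagonalHom v
  obtain ⟨DB, hDB⟩ := exists_eigenbasisDiagonalHom w
  -- the diagonal similitudes `D(X(a, c))` lie in `C(A)^×`, in `L(A)|_{H¹}`, with multiplier `c` for every polarization
  have hmemA : ∀ ec : (Φ.1 → ℂˣ) × ℂˣ, DA (XA ec) ∈ centralizerGroup A ∧
      ∀ {h : complexBetti A.X 2}, IsPolarizationClass A.dim A.X h → ∀ x y : complexBetti A.X 1,
        polarizationPairingOne A.X h (A.dim - 1) (DA (XA ec) x) (DA (XA ec) y) =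
          ((ec.2 : ℂˣ) : ℂ) • polarizationPairingOne A.X h (A.dim - 1) x y := fun ec ↦ by
    have hc' : ∀ σ, ((XA ec σ : ℂˣ) : ℂ) * XA ec (conjugate σ) = ec.2 := fun σ ↦ by rw [← Units.val_mul, hXA3]
    refine ⟨mem_centralizerGroup_of_apply_basis_eq_smul hA hθ hv (hDA (XA ec)), fun hpol x y ↦ ?_⟩
    obtain ⟨g, hg, hg1⟩ := mem_map_lefschetzGroup_one_of_eigenvalues hA hθ hv (hDA (XA ec)) hc'
    have hg1' : g 1 = DA (XA ec) := hg1
    rw [← hg1']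
    exact polarizationPairingOne_eq_smul_of_mem_lefschetzGroup_of_eigenvalues hA hv hg
      (d := fun σ ↦ ((XA ec σ : ℂˣ) : ℂ)) (fun σ ↦ by rw [hg1', hDA]) hc' hpol x y
  have hmemB : ∀ ec : (Ψ.1 → ℂˣ) × ℂˣ, DB (XB ec) ∈ centralizerGroup B ∧
      ∀ {h : complexBetti B.X 2}, IsPolarizationClass B.dim B.X h → ∀ x y : complexBetti B.X 1,
        polarizationPairingOne B.X h (B.dim - 1) (DB (XB ec) x) (DB (XB ec) y) =
          ((ec.2 : ℂˣ) : ℂ) • polarizationPairingOne B.X h (B.dim - 1) x y := fun ec ↦ by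
    have hc' : ∀ τ, ((XB ec τ : ℂˣ) : ℂ) * XB ec (conjugate τ) = ec.2 := fun τ ↦ by rw [← Units.val_mul, hXB3]
    refine ⟨mem_centralizerGroup_of_apply_basis_eq_smul hB hθ' hw (hDB (XB ec)), fun hpol x y ↦ ?_⟩
    obtain ⟨g, hg, hg1⟩ := mem_map_lefschetzGroup_one_of_eigenvalues hB hθ' hw (hDB (XB ec)) hc'
    have hg1' : g 1 = DB (XB ec) := hg1
    rw [← hg1']
    exact polarizationPairingOne_eq_smul_of_mem_lefschetzGroup_of_eigenvalues hB hw hg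
      (d := fun τ ↦ ((XB ec τ : ℂˣ) : ℂ)) (fun τ ↦ by rw [hg1', hDB]) hc' hpol x y
  -- the homomorphism `(a, b, c) ↦ (D_A X_A(a, c), D_B X_B(b, c))` into the fibre product
  let T := (Φ.1 → ℂˣ) × (Ψ.1 → ℂˣ) × ℂˣ
  let πA : T →* (Φ.1 → ℂˣ) × ℂˣ := (MonoidHom.fst _ _).prod ((MonoidHom.snd _ _).comp (MonoidHom.snd _ _))
  let πB : T →* (Ψ.1 → ℂˣ) × ℂˣ :=
    ((MonoidHom.fst _ _).comp (MonoidHom.snd _ _)).prod ((MonoidHom.snd _ _).comp (MonoidHom.snd _ _))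
  let f : T →* (complexBetti A.X 1 ≃ₗ[ℂ] complexBetti A.X 1) × (complexBetti B.X 1 ≃ₗ[ℂ] complexBetti B.X 1) :=
    (DA.comp (XA.comp πA)).prod (DB.comp (XB.comp πB))
  have hf : ∀ t : T, f t = (DA (XA (t.1, t.2.2)), DB (XB (t.2.1, t.2.2))) := fun _ ↦ rfl
  let F : T →* similitudeCentralizerGroupFibreProd A B hA₂ hB₂ :=
    f.codRestrict _ fun t ↦ by
      rw [hf]
      exact ⟨(hmemA _).1, (hmemB _).1, t.2.2, (hmemA (t.1, t.2.2)).2 hpolA, (hmemB (t.2.1, t.2.2)).2 hpolB⟩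
  have hF : ∀ t : T, ((F t : similitudeCentralizerGroupFibreProd A B hA₂ hB₂) :
      (complexBetti A.X 1 ≃ₗ[ℂ] complexBetti A.X 1) × (complexBetti B.X 1 ≃ₗ[ℂ] complexBetti B.X 1)) =
        (DA (XA (t.1, t.2.2)), DB (XB (t.2.1, t.2.2))) := fun _ ↦ rfl
  have hbij : Function.Bijective F := by
    refine ⟨fun t t' h ↦ ?_, fun p ↦ ?_⟩
    · have h' := congrArg Subtype.val h
      rw [hF, hF, Prod.mk.injEq] at h'
      have eA : XA (t.1, t.2.2) = XA (t'.1, t'.2.2) := funext fun σ ↦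
        Units.ext (eigenvalue_eq_of_eq (d := fun σ ↦ ((XA (t.1, t.2.2) σ : ℂˣ) : ℂ))
          (d' := fun σ ↦ ((XA (t'.1, t'.2.2) σ : ℂˣ) : ℂ)) (hDA _) (fun σ ↦ by rw [h'.1, hDA]) σ)
      have eB : XB (t.2.1, t.2.2) = XB (t'.2.1, t'.2.2) := funext fun τ ↦
        Units.ext (eigenvalue_eq_of_eq (d := fun τ ↦ ((XB (t.2.1, t.2.2) τ : ℂˣ) : ℂ))
          (d' := fun τ ↦ ((XB (t'.2.1, t'.2.2) τ : ℂˣ) : ℂ)) (hDB _) (fun τ ↦ by rw [h'.2, hDB]) τ)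
      have k1 : XA (t.1, t.2.2) φ₀ * XA (t.1, t.2.2) (conjugate φ₀) = t.2.2 := hXA3 _ φ₀
      have k2 : XA (t'.1, t'.2.2) φ₀ * XA (t'.1, t'.2.2) (conjugate φ₀) = t'.2.2 := hXA3 _ φ₀
      refine Prod.ext (funext fun φ ↦ ?_) (Prod.ext (funext fun ψ ↦ ?_) ?_)
      · have e1 : XA (t.1, t.2.2) φ = t.1 φ := hXA1 _ φ
        have e2 : XA (t'.1, t'.2.2) φ = t'.1 φ := hXA1 _ φ
        rw [← e1, ← e2, eA]
      · have e1 : XB (t.2.1, t.2.2) ψ = t.2.1 ψ := hXB1 _ ψ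
        have e2 : XB (t'.2.1, t'.2.2) ψ = t'.2.1 ψ := hXB1 _ ψ
        rw [← e1, ← e2, eB]
      · rw [← k1, ← k2, eA]
    · obtain ⟨hp1, hp2, c, hcA, hcB⟩ := p.2
      -- the `A`-component: diagonal, in `L(A)|_{H¹}`, eigenvalues `d` with `d_σ d_σ̄ = c`
      obtain ⟨d, hd⟩ := hA.exists_units_eigenvalues_of_mem_centralizerGroup hv hp1
      have hgA : p.1.1 ∈ (lefschetzGroup A.dim A.X).map
          (Pi.evalMonoidHom (fun k : ℕ ↦ complexBetti A.X k ≃ₗ[ℂ] complexBetti A.X k) 1) := by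
        rw [hpolA.lefschetzGroup_map_one_eq hA1]
        exact ⟨hp1, c, hcA⟩
      obtain ⟨g, hg, hg1⟩ := hgA
      have hg1' : g 1 = p.1.1 := hg1
      obtain ⟨d₂, c₂, hd₂, hc₂⟩ := exists_eigenvalues_multiplier_of_mem_lefschetzGroup hA hv hg
      have hdd : ∀ σ, d σ = d₂ σ := fun σ ↦ Units.ext (eigenvalue_eq_of_eq (d := fun σ ↦ ((d σ : ℂˣ) : ℂ))
        (d' := fun σ ↦ ((d₂ σ : ℂˣ) : ℂ)) hd (fun σ ↦ by rw [← hg1', hd₂]) σ)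
      have hc₂' : c₂ = c := by
        refine multiplier_unique (u := p.1.1) (h := hA₂) (fun x y ↦ ?_) hcA
          (hpolA.exists_polarizationPairingOne_ne_zero hA1)
        rw [← hg1']
        exact polarizationPairingOne_eq_smul_of_mem_lefschetzGroup_of_eigenvalues hA hv hg
          (d := fun σ ↦ ((d₂ σ : ℂˣ) : ℂ)) hd₂ (c := ((c₂ : ℂˣ) : ℂ)) (fun σ ↦ by rw [← Units.val_mul, hc₂]) hpolA x y
      have hdc : ∀ σ, d σ * d (conjugate σ) = c := fun σ ↦ by rw [hdd, hdd, hc₂, hc₂']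
      -- the `B`-component
      obtain ⟨d', hd'⟩ := hB.exists_units_eigenvalues_of_mem_centralizerGroup hw hp2
      have hgB : p.1.2 ∈ (lefschetzGroup B.dim B.X).map
          (Pi.evalMonoidHom (fun k : ℕ ↦ complexBetti B.X k ≃ₗ[ℂ] complexBetti B.X k) 1) := by
        rw [hpolB.lefschetzGroup_map_one_eq hB1]
        exact ⟨hp2, c, hcB⟩
      obtain ⟨g', hg', hg'1⟩ := hgB
      have hg'1' : g' 1 = p.1.2 := hg'1
      obtain ⟨d₃, c₃, hd₃, hc₃⟩ := exists_eigenvalues_multiplier_of_mem_lefschetzGroup hB hw hg'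
      have hdd' : ∀ τ, d' τ = d₃ τ := fun τ ↦ Units.ext (eigenvalue_eq_of_eq (d := fun τ ↦ ((d' τ : ℂˣ) : ℂ))
        (d' := fun τ ↦ ((d₃ τ : ℂˣ) : ℂ)) hd' (fun τ ↦ by rw [← hg'1', hd₃]) τ)
      have hc₃' : c₃ = c := by
        refine multiplier_unique (u := p.1.2) (h := hB₂) (fun x y ↦ ?_) hcB
          (hpolB.exists_polarizationPairingOne_ne_zero hB1)
        rw [← hg'1']
        exact polarizationPairingOne_eq_smul_of_mem_lefschetzGroup_of_eigenvalues hB hw hg'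
          (d := fun τ ↦ ((d₃ τ : ℂˣ) : ℂ)) hd₃ (c := ((c₃ : ℂˣ) : ℂ)) (fun τ ↦ by rw [← Units.val_mul, hc₃]) hpolB x y
      have hdc' : ∀ τ, d' τ * d' (conjugate τ) = c := fun τ ↦ by rw [hdd', hdd', hc₃, hc₃']
      -- the preimage
      refine ⟨(fun φ ↦ d φ, fun ψ ↦ d' ψ, c), Subtype.ext ?_⟩
      have eXA : XA (fun φ : Φ.1 ↦ d φ, c) = d := hXA4 _ d (fun _ ↦ rfl) hdc
      have eXB : XB (fun ψ : Ψ.1 ↦ d' ψ, c) = d' := hXB4 _ d' (fun _ ↦ rfl) hdc'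
      rw [hF]
      change (DA (XA (fun φ : Φ.1 ↦ d φ, c)), DB (XB (fun ψ : Ψ.1 ↦ d' ψ, c))) = p.1
      rw [eXA, eXB]
      exact Prod.ext (eq_of_apply_basis_eq_smul (hDA d) hd) (eq_of_apply_basis_eq_smul (hDB d') hd')
  set e := (MulEquiv.ofBijective F hbij).symm with he
  have key : ∀ p : similitudeCentralizerGroupFibreProd A B hA₂ hB₂,
      (DA (XA ((e p).1, (e p).2.2)), DB (XB ((e p).2.1, (e p).2.2))) = p.1 := fun p ↦ by
    rw [← hF]
    exact congrArg Subtype.val ((MulEquiv.ofBijective F hbij).apply_symm_apply p)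
  have keyA : ∀ p : similitudeCentralizerGroupFibreProd A B hA₂ hB₂, p.1.1 = DA (XA ((e p).1, (e p).2.2)) :=
    fun p ↦ (congrArg Prod.fst (key p)).symm
  have keyB : ∀ p : similitudeCentralizerGroupFibreProd A B hA₂ hB₂, p.1.2 = DB (XB ((e p).2.1, (e p).2.2)) :=
    fun p ↦ (congrArg Prod.snd (key p)).symm
  refine ⟨e, fun p ↦ ⟨fun φ ↦ ?_, fun φ ↦ ?_, fun ψ ↦ ?_, fun ψ ↦ ?_, fun hpol x y ↦ ?_, fun hpol x y ↦ ?_⟩⟩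
  · rw [keyA, hDA, hXA1]
  · rw [keyA, hDA, hXA2]
  · rw [keyB, hDB, hXB1]
  · rw [keyB, hDB, hXB2]
  · rw [keyA]
    exact (hmemA _).2 hpol x y
  · rw [keyB]
    exact (hmemB _).2 hpol x y

/-- **`L(A × B)(ℂ) ≃* (Φ → ℂˣ) × (Ψ → ℂˣ) × ℂˣ`** for realisations `A` of `(K; Φ)` and `B` of `(K'; Ψ)` (`θ(K) ⊆ C(A)`,
`θ'(K') ⊆ C(B)`) with `Hom(A, B) = 0 = Hom(B, A)`: Cor. 4.7 «`(L(A), l(A)) ≅ ∏ (L(Aᵢ), l(Aᵢ))`» (fibre product over `𝔾_m`)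
composed with Prop. 2.5 on each factor — `(L, l)` of `A × B` is the torus `T^Ψ` of the CM algebra `K × K'` with its
character `t`, of rank `|Φ| + |Ψ| + 1`. [cite: Milne1999LefschetzClasses, Def. 4.6 and Cor. 4.7 (p. 660)] [cite: Milne1999, §2 Prop. 2.5 and A.7] -/
theorem nonempty_lefschetzGroup_prod_mulEquiv_pi_units_prod_pi_units_prod (hA : IsCMTypeRealisation Φ A ι θ)
    (hθ : ∀ a : K, θ a ∈ centralizerAlgebra A) (hB : IsCMTypeRealisation Ψ B ι' θ')
    (hθ' : ∀ b : K', θ' b ∈ centralizerAlgebra B) (hAB : ∀ f : A ⟶ B, f = 0) (hBA : ∀ g : B ⟶ A, g = 0) :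
    Nonempty (lefschetzGroup (A.prod B).dim (A.prod B).X ≃* (Φ.1 → ℂˣ) × (Ψ.1 → ℂˣ) × ℂˣ) := by
  obtain ⟨v, hv, -⟩ := Deligne1982.exists_eigenbasis_of_isCMTypeRealisation hA
  obtain ⟨w, hw, -⟩ := Deligne1982.exists_eigenbasis_of_isCMTypeRealisation hB
  obtain ⟨hA₂, hpolA⟩ := exists_isPolarizationClass (AbelianVariety.isSmoothProjective_holds (A := A))
  obtain ⟨hB₂, hpolB⟩ := exists_isPolarizationClass (AbelianVariety.isSmoothProjective_holds (A := B))
  obtain ⟨e₁⟩ := nonempty_lefschetzGroup_prod_mulEquiv_fibreProd hAB hBA hpolA hpolB (one_le_dim hA) (one_le_dim hB)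
  obtain ⟨e₂, -⟩ := exists_similitudeCentralizerGroupFibreProd_mulEquiv_pi_units_prod hA hθ hv hB hθ' hw hpolA hpolB
  exact ⟨e₁.trans e₂⟩

/-- **`L(X)(ℂ) ≃* (Φ → ℂˣ) × (Ψ → ℂˣ) × ℂˣ` for every `X ∼ A^{r+1} × B^{s+1}`** (`A`, `B` Hom-orthogonal CM realisations as
above): Cor. 4.7 with two isogeny types («an isogeny `A → A₁^{r₁} × ⋯ × A_s^{r_s}` […] defines an isomorphism
`(L(A), l(A)) → ∏ᵢ (L(Aᵢ), l(Aᵢ))`»), read on the CM tori. [cite: Milne1999LefschetzClasses, Prop. 1.5 (p. 644) and Cor. 4.7 (p. 660)]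
[cite: Milne1999, §2 Prop. 2.5 and A.7] -/
theorem nonempty_lefschetzGroup_mulEquiv_pi_units_prod_pi_units_prod_of_isIsogenous_powSucc_prod_powSucc
    (hA : IsCMTypeRealisation Φ A ι θ) (hθ : ∀ a : K, θ a ∈ centralizerAlgebra A) (hB : IsCMTypeRealisation Ψ B ι' θ')
    (hθ' : ∀ b : K', θ' b ∈ centralizerAlgebra B) (hAB : ∀ f : A ⟶ B, f = 0) (hBA : ∀ g : B ⟶ A, g = 0) (r s : ℕ)
    (hX : AbelianVariety.IsIsogenous X ((A.powSucc r).prod (B.powSucc s))) :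
    Nonempty (lefschetzGroup X.dim X.X ≃* (Φ.1 → ℂˣ) × (Ψ.1 → ℂˣ) × ℂˣ) := by
  obtain ⟨v, hv, -⟩ := Deligne1982.exists_eigenbasis_of_isCMTypeRealisation hA
  obtain ⟨w, hw, -⟩ := Deligne1982.exists_eigenbasis_of_isCMTypeRealisation hB
  obtain ⟨hA₂, hpolA⟩ := exists_isPolarizationClass (AbelianVariety.isSmoothProjective_holds (A := A))
  obtain ⟨hB₂, hpolB⟩ := exists_isPolarizationClass (AbelianVariety.isSmoothProjective_holds (A := B))
  obtain ⟨e₁⟩ := nonempty_lefschetzGroup_mulEquiv_fibreProd_of_isIsogenous_powSucc_prod_powSucc hAB hBA hpolA hpolB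
    (one_le_dim hA) (one_le_dim hB) r s hX
  obtain ⟨e₂, -⟩ := exists_similitudeCentralizerGroupFibreProd_mulEquiv_pi_units_prod hA hθ hv hB hθ' hw hpolA hpolB
  exact ⟨e₁.trans e₂⟩

/-- **`L(A × B)(ℂ) ≃* (ℂˣ)^{dim A} × (ℂˣ)^{dim B} × ℂˣ`** — a split torus of rank `dim A + dim B + 1 = dim (A × B) + 1` — for
Hom-orthogonal CM realisations `A`, `B` (`|Φ| = dim A`, `|Ψ| = dim B`). [cite: Milne1999LefschetzClasses, Cor. 4.7 (p. 660) and §3 p. 657]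
[cite: Milne1999, §2 Prop. 2.5] -/
theorem nonempty_lefschetzGroup_prod_mulEquiv_fin_prod_fin_prod (hA : IsCMTypeRealisation Φ A ι θ)
    (hθ : ∀ a : K, θ a ∈ centralizerAlgebra A) (hB : IsCMTypeRealisation Ψ B ι' θ')
    (hθ' : ∀ b : K', θ' b ∈ centralizerAlgebra B) (hAB : ∀ f : A ⟶ B, f = 0) (hBA : ∀ g : B ⟶ A, g = 0) :
    Nonempty (lefschetzGroup (A.prod B).dim (A.prod B).X ≃* (Fin A.dim → ℂˣ) × (Fin B.dim → ℂˣ) × ℂˣ) := by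
  obtain ⟨e⟩ := nonempty_lefschetzGroup_prod_mulEquiv_pi_units_prod_pi_units_prod hA hθ hB hθ' hAB hBA
  obtain ⟨eA⟩ := nonempty_pi_units_mulEquiv_fin hA
  obtain ⟨eB⟩ := nonempty_pi_units_mulEquiv_fin hB
  exact ⟨e.trans (MulEquiv.prodCongr eA (MulEquiv.prodCongr eB (MulEquiv.refl ℂˣ)))⟩

/-- `L(X)(ℂ) ≃* (ℂˣ)^{dim A} × (ℂˣ)^{dim B} × ℂˣ` for every `X ∼ A^{r+1} × B^{s+1}` (Hom-orthogonal CM realisations): the rank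
`dim A + dim B + 1` of `L(X)` depends only on the two isogeny types. [cite: Milne1999LefschetzClasses, Prop. 1.5 (p. 644) and Cor. 4.7 (p. 660)]
[cite: Milne1999, §2 Prop. 2.5] -/
theorem nonempty_lefschetzGroup_mulEquiv_fin_prod_fin_prod_of_isIsogenous_powSucc_prod_powSucc
    (hA : IsCMTypeRealisation Φ A ι θ) (hθ : ∀ a : K, θ a ∈ centralizerAlgebra A) (hB : IsCMTypeRealisation Ψ B ι' θ')
    (hθ' : ∀ b : K', θ' b ∈ centralizerAlgebra B) (hAB : ∀ f : A ⟶ B, f = 0) (hBA : ∀ g : B ⟶ A, g = 0) (r s : ℕ)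
    (hX : AbelianVariety.IsIsogenous X ((A.powSucc r).prod (B.powSucc s))) :
    Nonempty (lefschetzGroup X.dim X.X ≃* (Fin A.dim → ℂˣ) × (Fin B.dim → ℂˣ) × ℂˣ) := by
  obtain ⟨e⟩ := nonempty_lefschetzGroup_mulEquiv_pi_units_prod_pi_units_prod_of_isIsogenous_powSucc_prod_powSucc hA hθ
    hB hθ' hAB hBA r s hX
  obtain ⟨eA⟩ := nonempty_pi_units_mulEquiv_fin hA
  obtain ⟨eB⟩ := nonempty_pi_units_mulEquiv_fin hB
  exact ⟨e.trans (MulEquiv.prodCongr eA (MulEquiv.prodCongr eB (MulEquiv.refl ℂˣ)))⟩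

/-- **Two non-isogenous SIMPLE CM abelian varieties**: `L(A × B)(ℂ) ≃* (Φ → ℂˣ) × (Ψ → ℂˣ) × ℂˣ` — Hom-orthogonality is
automatic («a non-zero homomorphism between simple abelian varieties is an isogeny»), the verbatim shape of Cor. 4.7
(simple, pairwise non-isogenous factors). [cite: MumfordAV1970, §19 Cor. 2 of Thm. 1 (p. 174)]
[cite: Milne1999LefschetzClasses, Cor. 4.7 (p. 660)] [cite: Milne1999, §2 Prop. 2.5] -/
theorem nonempty_lefschetzGroup_prod_mulEquiv_pi_units_prod_pi_units_prod_of_isSimple (hA : IsCMTypeRealisation Φ A ι θ)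
    (hθ : ∀ a : K, θ a ∈ centralizerAlgebra A) (hB : IsCMTypeRealisation Ψ B ι' θ')
    (hθ' : ∀ b : K', θ' b ∈ centralizerAlgebra B) (hAs : AbelianVariety.IsSimple A) (hBs : AbelianVariety.IsSimple B)
    (hn : ¬ AbelianVariety.IsIsogenous A B) :
    Nonempty (lefschetzGroup (A.prod B).dim (A.prod B).X ≃* (Φ.1 → ℂˣ) × (Ψ.1 → ℂˣ) × ℂˣ) :=
  nonempty_lefschetzGroup_prod_mulEquiv_pi_units_prod_pi_units_prod hA hθ hB hθ'
    (hom_eq_zero_of_isSimple_of_not_isIsogenous hAs hBs hn)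
    (hom_eq_zero_of_isSimple_of_not_isIsogenous hBs hAs fun h ↦ hn h.symm')

/-- Two non-isogenous simple CM abelian varieties, every `X ∼ A^{r+1} × B^{s+1}`: `L(X)(ℂ) ≃* (Φ → ℂˣ) × (Ψ → ℂˣ) × ℂˣ`.
[cite: Milne1999LefschetzClasses, Prop. 1.5 (p. 644) and Cor. 4.7 (p. 660)] [cite: Milne1999, §2 Prop. 2.5]
[cite: MumfordAV1970, §19 Cor. 2 of Thm. 1 (p. 174)] -/
theorem nonempty_lefschetzGroup_mulEquiv_pi_units_prod_pi_units_prod_of_isSimple_of_isIsogenous_powSucc_prod_powSucc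
    (hA : IsCMTypeRealisation Φ A ι θ) (hθ : ∀ a : K, θ a ∈ centralizerAlgebra A) (hB : IsCMTypeRealisation Ψ B ι' θ')
    (hθ' : ∀ b : K', θ' b ∈ centralizerAlgebra B) (hAs : AbelianVariety.IsSimple A) (hBs : AbelianVariety.IsSimple B)
    (hn : ¬ AbelianVariety.IsIsogenous A B) (r s : ℕ) (hX : AbelianVariety.IsIsogenous X ((A.powSucc r).prod (B.powSucc s))) :
    Nonempty (lefschetzGroup X.dim X.X ≃* (Φ.1 → ℂˣ) × (Ψ.1 → ℂˣ) × ℂˣ) :=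
  nonempty_lefschetzGroup_mulEquiv_pi_units_prod_pi_units_prod_of_isIsogenous_powSucc_prod_powSucc hA hθ hB hθ'
    (hom_eq_zero_of_isSimple_of_not_isIsogenous hAs hBs hn)
    (hom_eq_zero_of_isSimple_of_not_isIsogenous hBs hAs fun h ↦ hn h.symm') r s hX

end Products

/-! ### §3 `MT(X)(ℂ)` inside the torus `(ℂˣ)^Φ × (ℂˣ)^Ψ × ℂˣ` -/

section MumfordTate

variable [IsCMField K] {K' : Type} [Field K'] [NumberField K'] [IsCMField K'] {Ψ : CMType K'}
  {B X : AbelianVariety ℂ} {ι' : 𝓞 K' →+* End B} {θ' : K' →+* Module.End ℂ (complexBetti B.X 1)}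

/-- `dim X ≥ 1` for `X ∼ A^{r+1} × B^{s+1}`, `dim A ≥ 1`. [folklore] -/
private theorem one_le_dim_of_isIsogenous_powSucc_prod_powSucc (hA1 : 1 ≤ A.dim) (r s : ℕ)
    (hX : AbelianVariety.IsIsogenous X ((A.powSucc r).prod (B.powSucc s))) : 1 ≤ X.dim := by
  obtain ⟨f, hf⟩ := hX
  rw [AbelianVariety.dim_eq_of_isIsogeny hf, AbelianVariety.dim_prod]
  have := dim_powSucc_pos hA1 r
  omega

/-- **«`L(A) ⊃ Hg(A)`» on the CM tori: `MT(X)(ℂ)` embeds in `(Φ → ℂˣ) × (Ψ → ℂˣ) × ℂˣ`** for every `X ∼ A^{r+1} × B^{s+1}`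
(`A`, `B` Hom-orthogonal CM realisations): `MT(X) ≤ L(X)` and §2; Deligne's «the Mumford–Tate group of `A` is contained in
`E^×`» for the CM algebra `E = K × K'`. [cite: Milne1999LefschetzClasses, §4 p. 660 (L(A) ⊃ Hg(A)) and Cor. 4.7]
[cite: Deligne1982HodgeCycles, I §5 proof of Prop. 5.1] [cite: Milne1999, §2 Prop. 2.5] -/
theorem exists_injective_monoidHom_mumfordTateGroup_pi_units_prod_pi_units_prod_of_isIsogenous_powSucc_prod_powSucc
    (hA : IsCMTypeRealisation Φ A ι θ) (hθ : ∀ a : K, θ a ∈ centralizerAlgebra A) (hB : IsCMTypeRealisation Ψ B ι' θ')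
    (hθ' : ∀ b : K', θ' b ∈ centralizerAlgebra B) (hAB : ∀ f : A ⟶ B, f = 0) (hBA : ∀ g : B ⟶ A, g = 0) (r s : ℕ)
    (hX : AbelianVariety.IsIsogenous X ((A.powSucc r).prod (B.powSucc s))) :
    ∃ f : mumfordTateGroup X.dim X.X →* (Φ.1 → ℂˣ) × (Ψ.1 → ℂˣ) × ℂˣ, Function.Injective f := by
  obtain ⟨e⟩ := nonempty_lefschetzGroup_mulEquiv_pi_units_prod_pi_units_prod_of_isIsogenous_powSucc_prod_powSucc hA hθ
    hB hθ' hAB hBA r s hX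
  exact ⟨e.toMonoidHom.comp (Subgroup.inclusion X.hodgeGroup_le_specialLefschetzGroup.2),
    e.injective.comp (Subgroup.inclusion_injective _)⟩

/-- `MT(X)(ℂ)` is commutative for every `X ∼ A^{r+1} × B^{s+1}`, `A`, `B` Hom-orthogonal CM realisations (a subgroup of a
torus). [cite: Milne1999LefschetzClasses, §4 p. 660 and Cor. 4.7] [cite: Deligne1982HodgeCycles, I §5 proof of Prop. 5.1] -/
theorem mumfordTateGroup_comm_of_isIsogenous_powSucc_prod_powSucc (hA : IsCMTypeRealisation Φ A ι θ)
    (hθ : ∀ a : K, θ a ∈ centralizerAlgebra A) (hB : IsCMTypeRealisation Ψ B ι' θ')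
    (hθ' : ∀ b : K', θ' b ∈ centralizerAlgebra B) (hAB : ∀ f : A ⟶ B, f = 0) (hBA : ∀ g : B ⟶ A, g = 0) (r s : ℕ)
    (hX : AbelianVariety.IsIsogenous X ((A.powSucc r).prod (B.powSucc s)))
    {g g' : ∀ k : ℕ, complexBetti X.X k ≃ₗ[ℂ] complexBetti X.X k} (hg : g ∈ mumfordTateGroup X.dim X.X)
    (hg' : g' ∈ mumfordTateGroup X.dim X.X) : g * g' = g' * g := by
  obtain ⟨f, hf⟩ :=
    exists_injective_monoidHom_mumfordTateGroup_pi_units_prod_pi_units_prod_of_isIsogenous_powSucc_prod_powSucc hA hθ hB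
      hθ' hAB hBA r s hX
  have h := mul_comm (f ⟨g, hg⟩) (f ⟨g', hg'⟩)
  rw [← map_mul, ← map_mul] at h
  exact congrArg Subtype.val (hf h)

/-- `L(X)(ℂ)` is commutative for every `X ∼ A^{r+1} × B^{s+1}`, `A`, `B` Hom-orthogonal CM realisations (a torus; cf.
`lefschetzGroup_comm_iff_isOfCMType`). [cite: Milne1999, §1 Rem. 1.10 («π(A) is commutative») and §2 Prop. 2.5]
[cite: Milne1999LefschetzClasses, Cor. 4.7 (p. 660)] -/
theorem lefschetzGroup_comm_of_isCMTypeRealisation_of_isIsogenous_powSucc_prod_powSucc (hA : IsCMTypeRealisation Φ A ι θ)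
    (hθ : ∀ a : K, θ a ∈ centralizerAlgebra A) (hB : IsCMTypeRealisation Ψ B ι' θ')
    (hθ' : ∀ b : K', θ' b ∈ centralizerAlgebra B) (hAB : ∀ f : A ⟶ B, f = 0) (hBA : ∀ g : B ⟶ A, g = 0) (r s : ℕ)
    (hX : AbelianVariety.IsIsogenous X ((A.powSucc r).prod (B.powSucc s)))
    {g g' : ∀ k : ℕ, complexBetti X.X k ≃ₗ[ℂ] complexBetti X.X k} (hg : g ∈ lefschetzGroup X.dim X.X)
    (hg' : g' ∈ lefschetzGroup X.dim X.X) : g * g' = g' * g := by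
  obtain ⟨e⟩ := nonempty_lefschetzGroup_mulEquiv_pi_units_prod_pi_units_prod_of_isIsogenous_powSucc_prod_powSucc hA hθ
    hB hθ' hAB hBA r s hX
  have h := mul_comm (e ⟨g, hg⟩) (e ⟨g', hg'⟩)
  rw [← map_mul, ← map_mul] at h
  exact congrArg Subtype.val (e.injective h)

/-- **`MT(X)(ℂ) ≃* (Φ → ℂˣ) × (Ψ → ℂˣ) × ℂˣ` if `X ∼ A^{r+1} × B^{s+1}` is STABLY NONDEGENERATE** (no power supports an
exotic Hodge class; Prop. 4.8 (a) ⟹ (b), `Hg(X) = L(X)` in Milne's `GL × 𝔾_m` convention): then the Mumford–Tate group is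
the whole torus `T^Ψ(ℂ)` of the CM algebra `K × K'`. [cite: Milne1999LefschetzClasses, Prop. 4.8 (p. 660) and Cor. 4.7]
[cite: Gordon1999HodgeAVSurvey, Thm. 7.5 and Def. 7.6] [cite: Milne1999, §2 Prop. 2.5] -/
theorem nonempty_mumfordTateGroup_mulEquiv_pi_units_prod_pi_units_prod_of_isStablyNondegenerate
    (hA : IsCMTypeRealisation Φ A ι θ) (hθ : ∀ a : K, θ a ∈ centralizerAlgebra A) (hB : IsCMTypeRealisation Ψ B ι' θ')
    (hθ' : ∀ b : K', θ' b ∈ centralizerAlgebra B) (hAB : ∀ f : A ⟶ B, f = 0) (hBA : ∀ g : B ⟶ A, g = 0) (r s : ℕ)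
    (hX : AbelianVariety.IsIsogenous X ((A.powSucc r).prod (B.powSucc s))) (hS : IsStablyNondegenerate X) :
    Nonempty (mumfordTateGroup X.dim X.X ≃* (Φ.1 → ℂˣ) × (Ψ.1 → ℂˣ) × ℂˣ) := by
  obtain ⟨e⟩ := nonempty_lefschetzGroup_mulEquiv_pi_units_prod_pi_units_prod_of_isIsogenous_powSucc_prod_powSucc hA hθ
    hB hθ' hAB hBA r s hX
  have hX1 := one_le_dim_of_isIsogenous_powSucc_prod_powSucc (B := B) (one_le_dim hA) r s hX
  exact ⟨(MulEquiv.subgroupCongr ((X.mumfordTateGroup_eq_lefschetzGroup_iff_forall_isDivisorGenerated hX1).2 hS)).trans e⟩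

/-- The product case: `MT(A × B)(ℂ) ≃* (Φ → ℂˣ) × (Ψ → ℂˣ) × ℂˣ` when `A × B` is stably nondegenerate (Hom-orthogonal CM
realisations). [cite: Milne1999LefschetzClasses, Prop. 4.8 (p. 660) and Cor. 4.7] [cite: Milne1999, §2 Prop. 2.5] -/
theorem nonempty_mumfordTateGroup_prod_mulEquiv_pi_units_prod_pi_units_prod_of_isStablyNondegenerate
    (hA : IsCMTypeRealisation Φ A ι θ) (hθ : ∀ a : K, θ a ∈ centralizerAlgebra A) (hB : IsCMTypeRealisation Ψ B ι' θ')
    (hθ' : ∀ b : K', θ' b ∈ centralizerAlgebra B) (hAB : ∀ f : A ⟶ B, f = 0) (hBA : ∀ g : B ⟶ A, g = 0)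
    (hS : IsStablyNondegenerate (A.prod B)) :
    Nonempty (mumfordTateGroup (A.prod B).dim (A.prod B).X ≃* (Φ.1 → ℂˣ) × (Ψ.1 → ℂˣ) × ℂˣ) := by
  obtain ⟨e⟩ := nonempty_lefschetzGroup_prod_mulEquiv_pi_units_prod_pi_units_prod hA hθ hB hθ' hAB hBA
  have h1 : 1 ≤ (A.prod B).dim := by
    rw [AbelianVariety.dim_prod]
    have := one_le_dim hA
    omega
  exact ⟨(MulEquiv.subgroupCongr
    (((A.prod B).mumfordTateGroup_eq_lefschetzGroup_iff_forall_isDivisorGenerated h1).2 hS)).trans e⟩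

end MumfordTate

end Literature.AlgebraicGeometry.Milne1999

end
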